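import Literature.NumberTheory.EllipticCurves.KuriharaNumber
import Literature.NumberTheory.EllipticCurves.KatoKolyvaginPrimes
import Literature.NumberTheory.EllipticCurves.CuspFormLFunction
import Mathlib.Algebra.MonoidAlgebra.Basic
import Mathlib.RingTheory.Ideal.Operations
import HarnessLib

/-!
# Crux `SelmerRankLB` (stmt-BirchSwinnertonDyer-0131), line `kurihara_order` — the open stub V2b follows from the ANALYTIC Mazur–Tate depth of the modular element (typed bridge for idea `analytic-mazur-tate-depth`)

Lead prover of the line (`prover-line-stmt-BirchSwinnertonDyer-0131-0`), 2026-08-17.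

The open stub V2b (`stub_delta_evenGap`) asks that the Kurihara number
`δ_n^{(k)} = Σ_{a ∈ (ℤ/n)ˣ} \overline{[a/n]⁺_f} · Π_{ℓ ∣ n} log_ℓ(a) ∈ ℤ/p^k` of the newform `f` of `E`
vanish whenever `2 ≤ ν(n) < r_an = ord_{s=1} L(E, s)` (same parity). The crux idea card
`Cruxes/SelmerRankLB/Ideas/analytic-mazur-tate-depth.md` (lens "strengthen") proposes to get it from
the ANALYTIC-RANK form of Mazur–Tate's "order of vanishing" statement for the modular element
`θ_{E,n} = Σ_a [a/n]⁺ σ_a ∈ R[(ℤ/n)ˣ]` (Mazur–Tate 1987, §1, with `rank E(ℚ)` replaced by `r_an`):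

  `(S⁺)  θ̄_{f,n}^{(k)} := Σ_{a ∈ (ℤ/n)ˣ} \overline{[a/n]⁺_f} · [a] ∈ I^{r_an} ⊆ (ℤ/p^k)[(ℤ/n)ˣ]`,

`I` the augmentation ideal. This file proves the card's "first lemma" in full generality and the
resulting bridge, sorry-free:

* `mtDepth_sum_mul_prod_eq_zero_of_mem_pow` — **products of `d` additive characters kill the
  `(d+1)`-st power of the augmentation ideal** (Passi's "polynomial maps on groups", degree `d`):
  for a commutative ring `R`, a commutative group `G`, functions `λ_i : G → R` with
  `λ_i(gh) = λ_i(g) + λ_i(h)`, a finite set `S` of indices and `x = Σ_g x_g [g] ∈ I^{#S + 1}`: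
  `Σ_g x_g · Π_{i ∈ S} λ_i(g) = 0`. (Induction on `#S` through the Leibniz-type rule
  `Φ_S(x·[g]) = Σ_{T ⊆ S} (Π_{i ∈ S∖T} λ_i(g)) Φ_T(x)`, `mtDepth_sum_mul_single`.)
* `mtDepth_kuriharaNumber_eq_sum` — the Kurihara number IS such a functional of the modular element:
  `kuriharaNumber f m n ψ = Φ_{primeFactors n}(θ̄_{f,n})` with `λ_ℓ = log via ψ_ℓ`.
* `stub_delta_evenGap_of_mazurTateDepth` — **(S⁺) ⇒ V2b** (indeed ⇒ the whole of (KV)): if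
  `θ̄_{f,n}^{(k)} ∈ I^{r_an}` at every Kolyvagin level, then `δ_n^{(k)} = 0` whenever `ν(n) < r_an`
  (registered as a sub-goal of the crux item by `ledger workitem stub-add`; (S⁺) is written out
  literally as a hypothesis — it is an OPEN prediction, Mazur–Tate's depth statement in analytic-rank
  form, not a named fact, and no `def` is minted for it).

Honest value (census `STRATEGY-CENSUS.md` §(S1)): (S⁺) is STRONGER than V2b and every theorem towards
it in print starts from the algebraic side (Ota 2018, Thm. 5.17: `θ ∈ I^{min(r_{p^∞}, p)}` from the
Selmer corank), so this bridge gives no new leverage on the crux; it makes the idea card's target a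
precise, kernel-checked statement and records that the bookkeeping between "depth of `θ`" and
"vanishing of `δ`" is done. CONDITIONAL; credits nothing to the item.

References: B. Mazur, J. Tate, *Refined conjectures of the "Birch and Swinnerton-Dyer type"*, Duke
Math. J. 54 (1987), §1; I. B. S. Passi, *Group rings and their augmentation ideals*, LNM 715 (1979),
Ch. V (polynomial maps); C.-H. Kim, arXiv:2203.12159, §3.5; K. Ota, Amer. J. Math. 140 (2018), Thm. 5.17.
-/

set_option linter.dupNamespace false

noncomputable section

namespace Summit.BirchSwinnertonDyer.BirchSwinnertonDyer.Theorems

open scoped MatrixGroups ModularForm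
open MonoidAlgebra CongruenceSubgroup Literature.NumberTheory.EllipticCurves
  Literature.NumberTheory.EllipticCurves.ModularForms

open Literature.NumberTheory.DiophantineGeometry.Dioph (ratModP)

/-! ### Polynomial functionals on a group ring: products of additive characters -/

section Passi

variable {R : Type*} [CommRing R] {G : Type*} {ι : Type*} (lam : ι → G → R)

/-- The functional `Φ_S(x) = Σ_g x_g Π_{i∈S} λ_i(g)` is additive in `x`. [folklore] -/
theorem mtDepth_sum_add (S : Finset ι) (x y : MonoidAlgebra R G) :
    ((x + y).coeff.sum fun g c ↦ c * ∏ i ∈ S, lam i g) =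
      (x.coeff.sum fun g c ↦ c * ∏ i ∈ S, lam i g) +
        (y.coeff.sum fun g c ↦ c * ∏ i ∈ S, lam i g) := by
  rw [coeff_add, Finsupp.sum_add_index']
  · intro g; exact zero_mul _
  · intro g a b; exact add_mul _ _ _

/-- The functional `Φ_S` on a monomial: `Φ_S(r[m]) = r Π_{i∈S} λ_i(m)`. [folklore] -/
theorem mtDepth_sum_single (S : Finset ι) (m : G) (r : R) :
    ((single m r : MonoidAlgebra R G).coeff.sum fun g c ↦ c * ∏ i ∈ S, lam i g) =
      r * ∏ i ∈ S, lam i m := by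
  rw [coeff_single, Finsupp.sum_single_index]
  exact zero_mul _

/-- The functional `Φ_S` is `R`-homogeneous: `Φ_S(c • x) = c Φ_S(x)`. [folklore] -/
theorem mtDepth_sum_smul (S : Finset ι) (c : R) (x : MonoidAlgebra R G) :
    ((c • x).coeff.sum fun g a ↦ a * ∏ i ∈ S, lam i g) =
      c * (x.coeff.sum fun g a ↦ a * ∏ i ∈ S, lam i g) := by
  rw [coeff_smul, Finsupp.sum_smul_index', Finsupp.mul_sum]
  · exact Finsupp.sum_congr fun g a ↦ by rw [smul_eq_mul, mul_assoc]
  · intro i; exact zero_mul _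

/-- The functional `Φ_S` as an additive map `R[G] → R`. [folklore] -/
theorem mtDepth_exists_addMonoidHom (S : Finset ι) :
    ∃ φ : MonoidAlgebra R G →+ R, ∀ x, φ x = x.coeff.sum fun g c ↦ c * ∏ i ∈ S, lam i g :=
  ⟨{ toFun := fun x ↦ x.coeff.sum fun g c ↦ c * ∏ i ∈ S, lam i g
     map_zero' := by simp
     map_add' := mtDepth_sum_add lam S }, fun _ ↦ rfl⟩

variable {lam} [CommGroup G] [DecidableEq ι]

/-- **Leibniz rule for `Φ_S` under translation by a group element**: for additive `λ_i`
(`λ_i(gh) = λ_i(g) + λ_i(h)`), `Φ_S(x·[g]) = Σ_{T ⊆ S} (Π_{i ∈ S∖T} λ_i(g)) · Φ_T(x)`.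
[folklore] -/
theorem mtDepth_sum_mul_single (hlam : ∀ i g h, lam i (g * h) = lam i g + lam i h)
    (S : Finset ι) (x : MonoidAlgebra R G) (g : G) :
    ((x * single g 1).coeff.sum fun h c ↦ c * ∏ i ∈ S, lam i h) =
      ∑ T ∈ S.powerset, (∏ i ∈ S \ T, lam i g) *
        (x.coeff.sum fun h c ↦ c * ∏ i ∈ T, lam i h) := by
  induction x using MonoidAlgebra.induction_linear with
  | zero => simp
  | add x y hx hy =>
    rw [add_mul, mtDepth_sum_add, hx, hy, ← Finset.sum_add_distrib]
    refine Finset.sum_congr rfl fun T _ ↦ ?_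
    rw [mtDepth_sum_add, mul_add]
  | single m r =>
    rw [single_mul_single, mul_one, mtDepth_sum_single]
    simp_rw [mtDepth_sum_single, hlam, Finset.prod_add, Finset.mul_sum]
    refine Finset.sum_congr rfl fun T _ ↦ ?_
    ring

/-- **Products of `d` additive characters are polynomial of degree `d`** (Passi): if
`x ∈ I^{#S + 1}`, `I = ker(ε : R[G] → R)` the augmentation ideal, then
`Φ_S(x) = Σ_g x_g Π_{i∈S} λ_i(g) = 0`. Proof by strong induction on `#S`: `I^{#S+1} = I^{#S}·I`; for
`m ∈ I^{#S}` and a group element `g`, the Leibniz rule gives `Φ_S(m[g]) = Φ_S(m) + Σ_{T ⊊ S} (…)Φ_T(m)`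
with every `Φ_T(m) = 0` by induction (`m ∈ I^{#S} ⊆ I^{#T+1}`), so `Φ_S(m·y) = ε(y)Φ_S(m) = 0` for
`y ∈ I`. [folklore] -/
theorem mtDepth_sum_mul_prod_eq_zero_of_mem_pow (hlam : ∀ i g h, lam i (g * h) = lam i g + lam i h) :
    ∀ (d : ℕ) (S : Finset ι), S.card = d → ∀ x : MonoidAlgebra R G,
      x ∈ RingHom.ker (MonoidAlgebra.lift R R G (1 : G →* R)) ^ (d + 1) →
      (x.coeff.sum fun g c ↦ c * ∏ i ∈ S, lam i g) = 0 := by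
  intro d
  induction d using Nat.strong_induction_on with
  | _ d ih =>
    intro S hS x hx
    set I : Ideal (MonoidAlgebra R G) := RingHom.ker (MonoidAlgebra.lift R R G (1 : G →* R)) with hI
    obtain ⟨φ, hφ⟩ := mtDepth_exists_addMonoidHom lam S
    -- the key step: `Φ_S(m · [g]) = Φ_S(m)` for `m ∈ I^d`
    have hkey : ∀ m ∈ I ^ d, ∀ g : G,
        ((m * single g 1).coeff.sum fun h c ↦ c * ∏ i ∈ S, lam i h) =
          m.coeff.sum fun h c ↦ c * ∏ i ∈ S, lam i h := by
      intro m hm g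
      rw [mtDepth_sum_mul_single hlam S m g, Finset.sum_eq_single_of_mem S
        (Finset.mem_powerset_self S)]
      · rw [Finset.sdiff_self, Finset.prod_empty, one_mul]
      · intro T hT hTS
        have hTlt : T.card < d := by
          rw [← hS]
          exact Finset.card_lt_card
            (lt_of_le_of_ne (Finset.mem_powerset.mp hT) hTS)
        have hmT : m ∈ I ^ (T.card + 1) := Ideal.pow_le_pow_right hTlt hm
        rw [ih T.card hTlt T rfl m hmT, mul_zero]
    -- `x ∈ I^(d+1) = I^d * I`
    rw [pow_succ] at hx
    rw [← hφ]
    refine Submodule.mul_induction_on hx (fun m hm y hy ↦ ?_) (fun a b ha hb ↦ by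
      rw [map_add, ha, hb, add_zero])
    -- `Φ_S(m * y) = ε(y) * Φ_S(m) = 0`
    have hy0 : (y.coeff.sum fun _ c ↦ c) = 0 := by
      have : MonoidAlgebra.lift R R G (1 : G →* R) y = 0 := hy
      rw [MonoidAlgebra.lift_apply] at this
      simpa using this
    have hmy : m * y = y.coeff.sum fun g c ↦ c • (m * single g 1) := by
      conv_lhs => rw [← sum_coeff_single y, Finsupp.mul_sum]
      refine Finsupp.sum_congr fun g _ ↦ ?_
      rw [show single g (y.coeff g) = y.coeff g • (single g 1 : MonoidAlgebra R G) by
        rw [smul_single', mul_one], mul_smul_comm]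
    calc φ (m * y) = y.coeff.sum fun g c ↦ φ (c • (m * single g 1)) := by
          rw [hmy, map_finsuppSum]
      _ = y.coeff.sum fun g c ↦ c * φ m := by
          refine Finsupp.sum_congr fun g _ ↦ ?_
          rw [hφ, hφ, mtDepth_sum_smul, hkey m hm g]
      _ = (y.coeff.sum fun _ c ↦ c) * φ m := by rw [Finsupp.sum_mul]
      _ = 0 := by rw [hy0, zero_mul]

end Passi

/-! ### The Kurihara number as a polynomial functional of the modular element -/

section Kurihara

variable {N : ℕ} (f : CuspForm (Gamma0 N) 2) (m n : ℕ) [NeZero n]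
  (ψ : (ℓ : ℕ) → (ZMod ℓ)ˣ →* Multiplicative (ZMod m))

omit [NeZero n] in
/-- The discrete logarithms `λ_ℓ(a) = ψ_ℓ(a mod ℓ)` (extended by `0` off the prime factors of `n`)
are additive characters of `(ℤ/n)ˣ`. [folklore] -/
theorem mtDepth_log_mul (ℓ : ℕ) (a b : (ZMod n)ˣ) :
    (if h : ℓ ∈ n.primeFactors then
        Multiplicative.toAdd (ψ ℓ (ZMod.unitsMap (Nat.dvd_of_mem_primeFactors h) (a * b))) else 0) =
      (if h : ℓ ∈ n.primeFactors then
          Multiplicative.toAdd (ψ ℓ (ZMod.unitsMap (Nat.dvd_of_mem_primeFactors h) a)) else 0) +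
        (if h : ℓ ∈ n.primeFactors then
          Multiplicative.toAdd (ψ ℓ (ZMod.unitsMap (Nat.dvd_of_mem_primeFactors h) b)) else 0) := by
  by_cases h : ℓ ∈ n.primeFactors
  · simp only [dif_pos h, map_mul, toAdd_mul]
  · simp only [dif_neg h, add_zero]

/-- **The Kurihara number is the top mixed coefficient of the modular element**:
`kuriharaNumber f m n ψ = Φ_{primeFactors n}(θ̄_{f,n})` for the group-ring element
`θ̄_{f,n} = Σ_{a ∈ (ℤ/n)ˣ} \overline{[a/n]⁺_f} · [a] ∈ (ℤ/m)[(ℤ/n)ˣ]` (the reduction mod `m` of the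
Mazur–Tate modular element built from the plus symbols, Mazur–Tate 1987 §1; Kurihara 2014 §1.1,
display (1): `δ̃_n` "is the coefficient of `Π_{ℓ∣n}(σ_{η_ℓ} − 1)`") and the functional
`Φ_S(x) = Σ_a x_a Π_{ℓ ∈ S} λ_ℓ(a)` with `λ_ℓ(a) = ψ_ℓ(a mod ℓ)`. [cite: Kurihara2014, §1.1 (1)–(2) (PDF p. 2)] -/
theorem mtDepth_kuriharaNumber_eq_sum :
    kuriharaNumber f m n ψ =
      ((∑ a : (ZMod n)ˣ, single a (ratModP m (ratPlusSymbol f ((((a : ZMod n).val : ℚ)) / n))) :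
          MonoidAlgebra (ZMod m) (ZMod n)ˣ).coeff.sum
        fun a c ↦ c * ∏ ℓ ∈ n.primeFactors,
          (if h : ℓ ∈ n.primeFactors then
            Multiplicative.toAdd (ψ ℓ (ZMod.unitsMap (Nat.dvd_of_mem_primeFactors h) a)) else 0)) := by
  obtain ⟨φ, hφ⟩ := mtDepth_exists_addMonoidHom (R := ZMod m) (G := (ZMod n)ˣ)
    (fun (ℓ : ℕ) (a : (ZMod n)ˣ) ↦ if h : ℓ ∈ n.primeFactors then
      Multiplicative.toAdd (ψ ℓ (ZMod.unitsMap (Nat.dvd_of_mem_primeFactors h) a)) else 0)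
    n.primeFactors
  rw [← hφ, map_sum, kuriharaNumber_def]
  refine Finset.sum_congr rfl fun a _ ↦ ?_
  rw [hφ, mtDepth_sum_single, ← Finset.prod_attach n.primeFactors]
  congr 1
  exact Finset.prod_congr rfl fun ℓ _ ↦ by rw [dif_pos ℓ.2]

end Kurihara

/-! ### The bridge: analytic Mazur–Tate depth ⇒ (KV) ⇒ V2b -/

section Bridge

/-- **Analytic Mazur–Tate depth ⇒ (KV).** If, at the crux's primes and for the newform `f` of `W`,
the reduced modular element `θ̄_{f,n}^{(k)} = Σ_{a ∈ (ℤ/n)ˣ} \overline{[a/n]⁺_f}·[a] ∈ (ℤ/p^k)[(ℤ/n)ˣ]`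
lies in the `r_an`-th power of the augmentation ideal for every `k ≥ 1` and `n ∈ 𝒩_k` (hypothesis
`hMT`, Mazur–Tate's "order of vanishing" statement, Duke 1987 §1, in ANALYTIC-rank form — an open
prediction, written out literally), then every Kurihara number `δ_n^{(k)}` with `ν(n) < r_an`
vanishes: `δ_n^{(k)} = Φ_{primeFactors n}(θ̄)` (`mtDepth_kuriharaNumber_eq_sum`) and `Φ_S` kills
`I^{#S+1} ⊇ I^{r_an}` (`mtDepth_sum_mul_prod_eq_zero_of_mem_pow`). CONDITIONAL. [cite: MazurTate1987, §1] -/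
theorem mtDepth_kuriharaNumber_eq_zero_of_mazurTateDepth
    (hMT : ∀ (W : WeierstrassCurve ℚ) [W.IsElliptic] [W.IsGloballyMinimal] (p : ℕ) [Fact p.Prime],
      5 ≤ p → W.HasGoodReductionAtPrime p → ¬ (p : ℤ) ∣ W.frobeniusTrace p →
      W.HasSurjectiveModNGaloisRep p →
      ∀ (_ : NeZero (W.conductorNorm ℤ)) (f : CuspForm (Gamma0 (W.conductorNorm ℤ)) 2),
        IsNewformOf W f →
        ∀ (k n : ℕ) [NeZero n], 1 ≤ k → Kato.IsKolyvaginProduct W p k n →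
          (∑ a : (ZMod n)ˣ,
              single a (ratModP (p ^ k) (ratPlusSymbol f ((((a : ZMod n).val : ℚ)) / n))) :
            MonoidAlgebra (ZMod (p ^ k)) (ZMod n)ˣ) ∈
            RingHom.ker (MonoidAlgebra.lift (ZMod (p ^ k)) (ZMod (p ^ k)) (ZMod n)ˣ
              (1 : (ZMod n)ˣ →* ZMod (p ^ k))) ^ W.analyticRank)
    (W : WeierstrassCurve ℚ) [W.IsElliptic] [W.IsGloballyMinimal] (p : ℕ) [Fact p.Prime]
    (h5 : 5 ≤ p) (hgood : W.HasGoodReductionAtPrime p) (hord : ¬ (p : ℤ) ∣ W.frobeniusTrace p)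
    (hsurj : W.HasSurjectiveModNGaloisRep p)
    (hN : NeZero (W.conductorNorm ℤ)) (f : CuspForm (Gamma0 (W.conductorNorm ℤ)) 2)
    (hf : IsNewformOf W f) (k n : ℕ) [NeZero n] (hk : 1 ≤ k)
    (hn : Kato.IsKolyvaginProduct W p k n) (hν : n.primeFactors.card < W.analyticRank)
    (ψ : (ℓ : ℕ) → (ZMod ℓ)ˣ →* Multiplicative (ZMod (p ^ k))) :
    kuriharaNumber f (p ^ k) n ψ = 0 := by
  classical
  rw [mtDepth_kuriharaNumber_eq_sum]
  exact mtDepth_sum_mul_prod_eq_zero_of_mem_pow (mtDepth_log_mul (p ^ k) n ψ)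
    n.primeFactors.card n.primeFactors rfl _
    (Ideal.pow_le_pow_right hν (hMT W p h5 hgood hord hsurj hN f hf k n hk hn))

/-- **Analytic Mazur–Tate depth ⇒ stub V2b** (`stub_delta_evenGap` of line `kurihara_order`, written
out verbatim as the consequent; registered as the sub-goal `stub_delta_evenGap_of_mazurTateDepth` of
the crux item by `ledger workitem stub-add`). Special case `2 ≤ ν(n) < r_an`, same parity, of
`mtDepth_kuriharaNumber_eq_zero_of_mazurTateDepth` (the side conditions and the surjectivity of `ψ`
are not used). This is the typed form of the crux idea `analytic-mazur-tate-depth`: it CONVERTS the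
open stub into the (stronger, equally open) depth statement and carries no claim of leverage.
CONDITIONAL; credits nothing. [cite: MazurTate1987, §1] -/
theorem stub_delta_evenGap_of_mazurTateDepth :
    (∀ (W : WeierstrassCurve ℚ) [W.IsElliptic] [W.IsGloballyMinimal] (p : ℕ) [Fact p.Prime],
      5 ≤ p → W.HasGoodReductionAtPrime p → ¬ (p : ℤ) ∣ W.frobeniusTrace p →
      W.HasSurjectiveModNGaloisRep p →
      ∀ (_ : NeZero (W.conductorNorm ℤ)) (f : CuspForm (Gamma0 (W.conductorNorm ℤ)) 2),
        IsNewformOf W f →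
        ∀ (k n : ℕ) [NeZero n], 1 ≤ k → Kato.IsKolyvaginProduct W p k n →
          (∑ a : (ZMod n)ˣ,
              single a (ratModP (p ^ k) (ratPlusSymbol f ((((a : ZMod n).val : ℚ)) / n))) :
            MonoidAlgebra (ZMod (p ^ k)) (ZMod n)ˣ) ∈
            RingHom.ker (MonoidAlgebra.lift (ZMod (p ^ k)) (ZMod (p ^ k)) (ZMod n)ˣ
              (1 : (ZMod n)ˣ →* ZMod (p ^ k))) ^ W.analyticRank) →
    ∀ (W : WeierstrassCurve ℚ) [W.IsElliptic] [W.IsGloballyMinimal] (p : ℕ) [Fact p.Prime],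
      5 ≤ p → W.HasGoodReductionAtPrime p → ¬ (p : ℤ) ∣ W.frobeniusTrace p →
      W.HasSurjectiveModNGaloisRep p →
      ∀ (_ : NeZero (W.conductorNorm ℤ)) (f : CuspForm (Gamma0 (W.conductorNorm ℤ)) 2),
        IsNewformOf W f →
        ∀ (k n : ℕ) [NeZero n], 1 ≤ k → Kato.IsKolyvaginProduct W p k n → 2 ≤ n.primeFactors.card →
          Even (n.primeFactors.card + W.analyticRank) →
          n.primeFactors.card < W.analyticRank →
          ∀ ψ : (ℓ : ℕ) → (ZMod ℓ)ˣ →* Multiplicative (ZMod (p ^ k)),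
            (∀ ℓ ∈ n.primeFactors, Function.Surjective (ψ ℓ)) →
            kuriharaNumber f (p ^ k) n ψ = 0 :=
  fun hMT W _ _ p _ h5 hgood hord hsurj hN f hf k n _ hk hn _ _ hν ψ _ ↦
    mtDepth_kuriharaNumber_eq_zero_of_mazurTateDepth hMT W p h5 hgood hord hsurj hN f hf k n hk hn hν ψ

end Bridge

end Summit.BirchSwinnertonDyer.BirchSwinnertonDyer.Theorems

end
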